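import Mathlib
import HarnessLib
import Summits.NavierStokesRegularity.NavierStokesRegularity.Theorems.PoloidalWindowRigidity.Negative.CellField

/-!
# Crux K2 `PoloidalWindowRigidity` (stmt-NavierStokesRegularity-19708) — negative side: the SEMI-ELLIPTIC THICK COLUMN,
# I: data, field, derivative (definitions and calculus)

Negative-side support (refuter seat ns-regularity-refuter1, KILLSHEET K-52; D-0081 §C).  Skeleton mixed_type v2
(`Cruxes/PoloidalWindowRigidity/Lines/mixed_type.lean`, sha16 0ad8e9d72766f0e2) re-types the elliptic research residue of
K2 as `stub_semiEllipticThick`: class (R)(C)(M)(D)(P), a non-degenerate pinned twisting window inside a time slab EVERY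
slice of which is SEMI-ELLIPTIC at EVERY point (`∂₂v₀·∂₀v₂ + ∂₂v₁·∂₁v₂ ≥ 0` on all of `ℝ³`), plus the THICK clause.  Every
(M)-free witness of the tree so far (`cellProfile`, `twistProfile`, `thickProfile`) is HYPERBOLIC, and the kinematic
identity `∂₂vₕ·∇ₕv₂ + (∂₂v₂)² = div (v₂ ∂₂v)` (divergence-free `v`) shows that no space-periodic or decaying field with
`∂₂v₂ ≢ 0` can be semi-elliptic everywhere: a semi-elliptic witness needs a far field with net flux.  This file builds one:
with `ρ(h) = 1/(1+h²)`, `ε = 1/8`,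
  `V(x) = (arctan x₂ + ε ρ(x₀) ρ'(x₂), 0, 1 + arctan x₀ + arctan x₁ − ε ρ'(x₀) ρ(x₂))`,
divergence-free (`∂₀V₀ = ε ρ'ρ' = −∂₂V₂`), poloidal along `e₂` (`V₀` does not see `x₁`, `V₁ = 0`), bounded (`‖V‖ ≤ 10`),
entire real-analytic, and STRICTLY ELLIPTIC AT EVERY POINT:
  `∂₂V₀·∂₀V₂ + ∂₂V₁·∂₁V₂ = (ρ(x₂) + ερ(x₀)ρ''(x₂))·(ρ(x₀) − ερ''(x₀)ρ(x₂)) ≥ (9/16) ρ(x₀)ρ(x₂) > 0`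
(`|ρ''| ≤ 2ρ`).  Here: the data `ρ, ρ₁ = ρ', ρ₂ = ρ''` with their signs and bounds, the field `seField`, its derivative
`seDeriv` as an explicit continuous linear map, components, and the norm bound.  Pattern and notation follow the accepted
siblings `…Negative.CellField`, `…LrcModEntire.Negative.ThickColumnField`.
WHAT THIS IS NOT: not a claim about Navier–Stokes regularity — explicit vector calculus for a kinematic witness. [folklore]
-/

noncomputable section

-- the summit and its single sub-problem share the name (CONVENTIONS §1), as in every Theorems file
set_option linter.dupNamespace false

namespace Summit.NavierStokesRegularity.NavierStokesRegularity.Theorems.PoloidalWindowRigidity.Negative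

open Set Function Filter Topology

local notation "E3" => EuclideanSpace ℝ (Fin 3)
local notation "π" i => (EuclideanSpace.proj (𝕜 := ℝ) (i : Fin 3) : EuclideanSpace ℝ (Fin 3) →L[ℝ] ℝ)
local notation "𝐞" i => (EuclideanSpace.single (i : Fin 3) (1 : ℝ) : EuclideanSpace ℝ (Fin 3))

/-! ## The one-variable data `ρ = 1/(1+h²)` and its first two derivatives -/

/-- `ρ(h) = 1/(1+h²)` (`= arctan'`). [folklore] -/
def seRho (h : ℝ) : ℝ := 1 / (1 + h ^ 2)

/-- `ρ₁ = ρ' = −2h/(1+h²)²`. [folklore] -/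
def seRho₁ (h : ℝ) : ℝ := -(2 * h) / (1 + h ^ 2) ^ 2

/-- `ρ₂ = ρ'' = (6h² − 2)/(1+h²)³`. [folklore] -/
def seRho₂ (h : ℝ) : ℝ := (6 * h ^ 2 - 2) / (1 + h ^ 2) ^ 3

/-- The coupling constant `ε = 1/8`. [folklore] -/
def seEps : ℝ := 1 / 8

/-- `arctan' = ρ`. [folklore] -/
theorem hasDerivAt_arctan_seRho (h : ℝ) : HasDerivAt Real.arctan (seRho h) h := Real.hasDerivAt_arctan h

/-- `ρ' = ρ₁`. [folklore] -/
theorem hasDerivAt_seRho (h : ℝ) : HasDerivAt seRho (seRho₁ h) h := by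
  have hne : (1 + h ^ 2 : ℝ) ≠ 0 := (show (0 : ℝ) < 1 + h ^ 2 by positivity).ne'
  have H := (hasDerivAt_const h (1 : ℝ)).div (((hasDerivAt_pow 2 h)).const_add 1) hne
  have e : seRho = fun y : ℝ => 1 / (1 + y ^ 2) := rfl
  rw [e]
  refine H.congr_deriv ?_
  rw [seRho₁]
  push_cast
  ring

/-- `ρ₁' = ρ₂`. [folklore] -/
theorem hasDerivAt_seRho₁ (h : ℝ) : HasDerivAt seRho₁ (seRho₂ h) h := by
  have hne : ((1 + h ^ 2) ^ 2 : ℝ) ≠ 0 := pow_ne_zero 2 (show (0 : ℝ) < 1 + h ^ 2 by positivity).ne'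
  have hne' : (1 + h ^ 2 : ℝ) ≠ 0 := (show (0 : ℝ) < 1 + h ^ 2 by positivity).ne'
  have hnum : HasDerivAt (fun y : ℝ => -(2 * y)) (-(2 : ℝ)) h :=
    (((hasDerivAt_id' h).const_mul (2 : ℝ)).neg).congr_deriv (by ring)
  have hden := ((hasDerivAt_pow 2 h).const_add (1 : ℝ)).pow 2
  have H := hnum.div hden hne
  have e : seRho₁ = fun y : ℝ => -(2 * y) / (1 + y ^ 2) ^ 2 := rfl
  rw [e]
  refine H.congr_deriv ?_
  rw [seRho₂]
  simp only [Pi.pow_apply]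
  field_simp
  ring

/-- `ρ > 0`. [folklore] -/
theorem seRho_pos (h : ℝ) : 0 < seRho h := by
  unfold seRho; positivity

/-- `ρ ≤ 1`. [folklore] -/
theorem seRho_le_one (h : ℝ) : seRho h ≤ 1 := by
  unfold seRho
  rw [div_le_one (show (0 : ℝ) < 1 + h ^ 2 by positivity)]
  nlinarith [sq_nonneg h]

/-- `ρ₂ ≤ 2ρ`. [folklore] -/
theorem seRho₂_le (h : ℝ) : seRho₂ h ≤ 2 * seRho h := by
  unfold seRho₂ seRho
  have hs := (show (0 : ℝ) < 1 + h ^ 2 by positivity)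
  rw [mul_one_div, div_le_div_iff₀ (pow_pos hs 3) hs]
  nlinarith [sq_nonneg (h ^ 2), sq_nonneg h, mul_pos hs hs]

/-- `−2ρ ≤ ρ₂`. [folklore] -/
theorem neg_le_seRho₂ (h : ℝ) : -(2 * seRho h) ≤ seRho₂ h := by
  unfold seRho₂ seRho
  have hs := (show (0 : ℝ) < 1 + h ^ 2 by positivity)
  rw [mul_one_div, ← neg_div, div_le_div_iff₀ hs (pow_pos hs 3)]
  nlinarith [sq_nonneg (h ^ 2), sq_nonneg h, mul_pos hs hs, mul_pos (mul_pos hs hs) hs]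

/-- `|ρ₁| ≤ 1`. [folklore] -/
theorem abs_seRho₁_le (h : ℝ) : |seRho₁ h| ≤ 1 := by
  unfold seRho₁
  have hs := (show (0 : ℝ) < 1 + h ^ 2 by positivity)
  rw [abs_div, abs_neg, abs_of_pos (pow_pos hs 2), div_le_one (pow_pos hs 2), abs_mul, abs_two]
  have ha : |h| ^ 2 = h ^ 2 := sq_abs h
  nlinarith [sq_nonneg (|h| - 1), abs_nonneg h, sq_nonneg h]

/-- `ρ₂ > 0` at the window abscissae `1 < h`. [folklore] -/
theorem seRho₂_pos {h : ℝ} (h1 : 1 < h) : 0 < seRho₂ h := by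
  unfold seRho₂
  have hs := (show (0 : ℝ) < 1 + h ^ 2 by positivity)
  exact div_pos (by nlinarith) (pow_pos hs 3)

/-- `ρ₁ < 0` at positive heights. [folklore] -/
theorem seRho₁_neg {h : ℝ} (h0 : 0 < h) : seRho₁ h < 0 := by
  unfold seRho₁
  exact div_neg_of_neg_of_pos (by linarith) (pow_pos (show (0 : ℝ) < 1 + h ^ 2 by positivity) 2)

/-- `ρ₁(0) = 0`. [folklore] -/
theorem seRho₁_zero : seRho₁ 0 = 0 := by simp [seRho₁]

/-- `|arctan| ≤ 2`. [folklore] -/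
theorem abs_arctan_le_two (h : ℝ) : |Real.arctan h| ≤ 2 := by
  have h1 := Real.arctan_lt_pi_div_two h
  have h2 := Real.neg_pi_div_two_lt_arctan h
  have hpi := Real.pi_le_four
  rw [abs_le]
  constructor <;> linarith

/-- **The vertical shear is positive everywhere**: `∂₂V₀ = ρ(x₂) + ερ(x₀)ρ₂(x₂) ≥ (3/4)ρ(x₂) > 0`. [folklore] -/
theorem seDzV0_pos (a b : ℝ) : 0 < seRho b + seEps * (seRho a * seRho₂ b) := by
  have ha := seRho_pos a
  have ha1 := seRho_le_one a
  have hb := seRho_pos b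
  have hlow := neg_le_seRho₂ b
  have h1 : -(2 * seRho b) ≤ seRho a * seRho₂ b := by nlinarith
  unfold seEps
  nlinarith

/-- **The horizontal gradient of the vertical velocity is positive everywhere**: `∂₀V₂ = ρ(x₀) − ερ₂(x₀)ρ(x₂) ≥ (3/4)ρ(x₀)
> 0`. [folklore] -/
theorem seDxV2_pos (a b : ℝ) : 0 < seRho a - seEps * (seRho₂ a * seRho b) := by
  have ha := seRho_pos a
  have hb := seRho_pos b
  have hb1 := seRho_le_one b
  have hup := seRho₂_le a
  have h1 : seRho₂ a * seRho b ≤ 2 * seRho a := by nlinarith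
  unfold seEps
  nlinarith

/-- **STRICT ELLIPTICITY of the type scalar at every point**: `(ρ(x₂) + ερ(x₀)ρ₂(x₂))·(ρ(x₀) − ερ₂(x₀)ρ(x₂)) > 0`. [folklore] -/
theorem seType_pos (a b : ℝ) :
    0 < (seRho b + seEps * (seRho a * seRho₂ b)) * (seRho a - seEps * (seRho₂ a * seRho b)) :=
  mul_pos (seDzV0_pos a b) (seDxV2_pos a b)

/-! ## The semi-elliptic thick column field and its derivative (definitions) -/

/-- The column `V(x) = (arctan x₂ + ε ρ(x₀) ρ₁(x₂), 0, 1 + arctan x₀ + arctan x₁ − ε ρ₁(x₀) ρ(x₂))`. [folklore] -/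
def seField (x : E3) : E3 :=
  (Real.arctan (x 2) + seEps * (seRho (x 0) * seRho₁ (x 2))) • (𝐞 0) +
    (1 + Real.arctan (x 0) + Real.arctan (x 1) - seEps * (seRho₁ (x 0) * seRho (x 2))) • (𝐞 2)

/-- The derivative `DV(x)`, as an explicit continuous linear map. [folklore] -/
def seDeriv (x : E3) : E3 →L[ℝ] E3 :=
  (seRho (x 2) • (π 2) + seEps • (seRho (x 0) • (seRho₂ (x 2) • (π 2)) + seRho₁ (x 2) • (seRho₁ (x 0) • (π 0)))).smulRight
      (𝐞 0) +
    (seRho (x 0) • (π 0) + seRho (x 1) • (π 1) -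
        seEps • (seRho₁ (x 0) • (seRho₁ (x 2) • (π 2)) + seRho (x 2) • (seRho₂ (x 0) • (π 0)))).smulRight (𝐞 2)

/-- The space–time window `(−1, 0) × {x | 1 < x₀ < 2, 1 < x₂ < 2}`. [folklore] -/
def seWindow : Set (ℝ × E3) :=
  Set.Ioo (-1 : ℝ) 0 ×ˢ {x : E3 | 1 < x 0 ∧ x 0 < 2 ∧ 1 < x 2 ∧ x 2 < 2}

/-- The profile `v(t, x) = (−t)^{-1/2} V(x)`. [folklore] -/
def seProfile (t : ℝ) (x : E3) : E3 := cellAmp t • seField x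

/-! ## Calculus of the field -/

/-- `V` is differentiable with derivative `seDeriv`. [folklore] -/
theorem hasFDerivAt_seField (x : E3) : HasFDerivAt seField (seDeriv x) x := by
  have h0 : HasFDerivAt (fun y : E3 => y 0) (π 0) x := (π 0).hasFDerivAt
  have h1 : HasFDerivAt (fun y : E3 => y 1) (π 1) x := (π 1).hasFDerivAt
  have h2 : HasFDerivAt (fun y : E3 => y 2) (π 2) x := (π 2).hasFDerivAt
  have hA0 := (hasDerivAt_arctan_seRho (x 0)).comp_hasFDerivAt x h0
  have hA1 := (hasDerivAt_arctan_seRho (x 1)).comp_hasFDerivAt x h1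
  have hA2 := (hasDerivAt_arctan_seRho (x 2)).comp_hasFDerivAt x h2
  have hR0 := (hasDerivAt_seRho (x 0)).comp_hasFDerivAt x h0
  have hR2 := (hasDerivAt_seRho (x 2)).comp_hasFDerivAt x h2
  have hS0 := (hasDerivAt_seRho₁ (x 0)).comp_hasFDerivAt x h0
  have hS2 := (hasDerivAt_seRho₁ (x 2)).comp_hasFDerivAt x h2
  have H := ((hA2.add ((hR0.mul hS2).const_mul seEps)).smul_const (𝐞 0)).add
    ((((hA0.const_add 1).add hA1).sub ((hS0.mul hR2).const_mul seEps)).smul_const (𝐞 2))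
  exact H

/-- `DV = seDeriv`. [folklore] -/
theorem fderiv_seField (x : E3) : fderiv ℝ seField x = seDeriv x :=
  (hasFDerivAt_seField x).fderiv

/-- `V` is continuous. [folklore] -/
theorem continuous_seField : Continuous seField := by
  have hd : Differentiable ℝ seField := fun x => (hasFDerivAt_seField x).differentiableAt
  exact hd.continuous

/-- `DV(x) w` in coordinates. [folklore] -/
theorem seDeriv_apply (x w : E3) : seDeriv x w =
    (seRho (x 2) * w 2 + seEps * (seRho (x 0) * (seRho₂ (x 2) * w 2) + seRho₁ (x 2) * (seRho₁ (x 0) * w 0))) • (𝐞 0) +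
    (seRho (x 0) * w 0 + seRho (x 1) * w 1 -
        seEps * (seRho₁ (x 0) * (seRho₁ (x 2) * w 2) + seRho (x 2) * (seRho₂ (x 0) * w 0))) • (𝐞 2) := by
  rfl

/-- The first component of `V(x)`. [folklore] -/
theorem seField_apply_zero (x : E3) : seField x 0 = Real.arctan (x 2) + seEps * (seRho (x 0) * seRho₁ (x 2)) := by
  simp [seField]

/-- The second component of `V(x)` vanishes. [folklore] -/
theorem seField_apply_one (x : E3) : seField x 1 = 0 := by
  simp [seField]

/-- The third component of `V(x)`. [folklore] -/
theorem seField_apply_two (x : E3) :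
    seField x 2 = 1 + Real.arctan (x 0) + Real.arctan (x 1) - seEps * (seRho₁ (x 0) * seRho (x 2)) := by
  simp [seField]

/-- The first component of `DV(x) w`. [folklore] -/
theorem seDeriv_apply_zero (x w : E3) : seDeriv x w 0 =
    seRho (x 2) * w 2 + seEps * (seRho (x 0) * (seRho₂ (x 2) * w 2) + seRho₁ (x 2) * (seRho₁ (x 0) * w 0)) := by
  rw [seDeriv_apply]; simp

/-- The second component of `DV(x) w` vanishes. [folklore] -/
theorem seDeriv_apply_one (x w : E3) : seDeriv x w 1 = 0 := by
  rw [seDeriv_apply]; simp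

/-- The third component of `DV(x) w`. [folklore] -/
theorem seDeriv_apply_two (x w : E3) : seDeriv x w 2 =
    seRho (x 0) * w 0 + seRho (x 1) * w 1 -
      seEps * (seRho₁ (x 0) * (seRho₁ (x 2) * w 2) + seRho (x 2) * (seRho₂ (x 0) * w 0)) := by
  rw [seDeriv_apply]; simp

/-- `‖V(x)‖ ≤ 10`. [folklore] -/
theorem norm_seField_le (x : E3) : ‖seField x‖ ≤ 10 := by
  have hA0 := abs_arctan_le_two (x 0)
  have hA1 := abs_arctan_le_two (x 1)
  have hA2 := abs_arctan_le_two (x 2)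
  have hR0 : |seRho (x 0)| ≤ 1 := by rw [abs_of_pos (seRho_pos _)]; exact seRho_le_one _
  have hR2 : |seRho (x 2)| ≤ 1 := by rw [abs_of_pos (seRho_pos _)]; exact seRho_le_one _
  have hS0 := abs_seRho₁_le (x 0)
  have hS2 := abs_seRho₁_le (x 2)
  have e0 : ‖(𝐞 0)‖ = 1 := by simp
  have e2 : ‖(𝐞 2)‖ = 1 := by simp
  have heps : |seEps| = 1 / 8 := by rw [seEps]; norm_num
  unfold seField
  refine (norm_add_le _ _).trans ?_
  rw [norm_smul, norm_smul, e0, e2, mul_one, mul_one, Real.norm_eq_abs, Real.norm_eq_abs]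
  have h1 : |Real.arctan (x 2) + seEps * (seRho (x 0) * seRho₁ (x 2))| ≤ 3 := by
    refine (abs_add_le _ _).trans ?_
    rw [abs_mul, abs_mul, heps]
    nlinarith [abs_nonneg (seRho (x 0)), abs_nonneg (seRho₁ (x 2))]
  have h2 : |1 + Real.arctan (x 0) + Real.arctan (x 1) - seEps * (seRho₁ (x 0) * seRho (x 2))| ≤ 6 := by
    refine (abs_sub _ _).trans ?_
    refine (add_le_add (abs_add_le _ _) le_rfl).trans ?_
    refine (add_le_add (add_le_add (abs_add_le _ _) le_rfl) le_rfl).trans ?_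
    rw [abs_one, abs_mul, abs_mul, heps]
    nlinarith [abs_nonneg (seRho₁ (x 0)), abs_nonneg (seRho (x 2))]
  linarith

end Summit.NavierStokesRegularity.NavierStokesRegularity.Theorems.PoloidalWindowRigidity.Negative

end
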